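import Summits.ResolutionOfSingularities.ResolutionOfSingularities.Theorems.WildQuotientsWildQuotientResolutionS1aProducerStep

/-!
# S1a — H3-scheme (i): re-indexing the grading of a tame node; the D2-T bridge for Rees-bigraded nodes [OURS · L1 W4.5c · idea-2 g15]

NOT a statement of the manuscript; counted 0. AI-level work, weaker than expert review. Plan-1 RULING
2026-08-27T20:04:51Z (5): «H3-scheme … re-index ℤ × Π ZMod(r j) ↦ Π ZMod(rʼ j) with rʼ₀ = 0 for the D2-T bridge».

PROVED (0 sorry): a grading `𝒜 : ι → AddSubgroup B` (`GradedRing 𝒜`) transported along an additive equivalence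
`e : ι ≃+ κ` is a grading `reindex 𝒜 e : κ → AddSubgroup B`, `reindex 𝒜 e k = 𝒜 (e.symm k)`
(`reindexGradedRing`), with the same degree-`0` part (`reindex_zero`); tame nodes stay tame nodes
(`isTameNode_reindex`: T1 — the unit degrees are mapped by `e` and the finite index is preserved,
`AddSubgroup.index_map_of_bijective`; T2 and the `σ`-clauses are untouched). The concrete equivalence
`consIndexEquiv r : ℤ × (Π j : Fin m, ZMod (r j)) ≃+ Π j : Fin (m+1), ZMod (Fin.cons 0 r j)` (new free coordinate
FIRST, `rʼ = Fin.cons 0 r`, `rʼ 0 = 0`), and the bridge `isTameRootChart_degreeZero_of_isTameNode_prod`: the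
degree-`0` part of a tame node bigraded by `ℤ × Π j, ZMod (r j)` — the shape produced by ONE weighted move on a
node graded by `Π j, ZMod (r j)` (H3 `ChartClause`: `𝒜ʼ : ℤ × ι → AddSubgroup (Localization.Away h)`) — is a tame
root chart in the sense of D2-T `S1.IsTameRootChart` (whose grading group is `Π j : Fin m', ZMod (r' j)` verbatim).
So the game never leaves the D2-T chart class: after `a` moves the node grading is `Π j : Fin (m+a), ZMod (rʼ j)`
with `a` zero entries in `rʼ`.
-/

set_option linter.dupNamespace false

noncomputable section

open scoped DirectSum
open Summit.ResolutionOfSingularities.ResolutionOfSingularities.Theorems.WildQuotientResolution.S1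

namespace Summit.ResolutionOfSingularities.ResolutionOfSingularities.Theorems.WildQuotientResolution.S1.ProducerStep

universe u v v'

section Reindex

variable {ι : Type v} {κ : Type v'} [AddCommGroup ι] [AddCommGroup κ]
  {B : Type u} [CommRing B] (𝒜 : ι → AddSubgroup B) (e : ι ≃+ κ)

/-- The grading re-indexed along `e : ι ≃+ κ`: `k ↦ 𝒜 (e⁻¹ k)`. [OURS · L1 W4.5c] -/
abbrev reindex (k : κ) : AddSubgroup B := 𝒜 (e.toEquiv.symm k)

/-- `reindex 𝒜 e k = 𝒜 (e⁻¹ k)`. -/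
theorem reindex_apply (k : κ) : reindex 𝒜 e k = 𝒜 (e.symm k) := rfl

/-- `reindex 𝒜 e (e i) = 𝒜 i`. -/
theorem reindex_apply_apply (i : ι) : reindex 𝒜 e (e i) = 𝒜 i := by
  change 𝒜 (e.symm (e i)) = 𝒜 i
  rw [e.symm_apply_apply]

/-- The degree-`0` part is unchanged. [OURS · L1 W4.5c] -/
theorem reindex_zero : reindex 𝒜 e 0 = 𝒜 0 := by
  change 𝒜 (e.symm 0) = 𝒜 0
  rw [map_zero]

variable [DecidableEq ι] [GradedRing 𝒜]

/-- The re-indexed grading is again a graded monoid. -/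
theorem reindex_gradedMonoid : SetLike.GradedMonoid (reindex 𝒜 e) where
  one_mem := by
    change (1 : B) ∈ 𝒜 (e.symm 0)
    rw [map_zero]
    exact SetLike.one_mem_graded 𝒜
  mul_mem := fun i j a b ha hb => by
    change a * b ∈ 𝒜 (e.symm (i + j))
    rw [map_add]
    exact SetLike.mul_mem_graded ha hb

/-- Transport of direct-sum elements along `e`. -/
def reindexSum : (⨁ i, ↥(𝒜 i)) ≃+ ⨁ k, ↥(reindex 𝒜 e k) :=
  DirectSum.equivCongrLeft e.toEquiv

/-- Components of a transported direct-sum element. -/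
theorem reindexSum_apply (x : ⨁ i, ↥(𝒜 i)) (k : κ) :
    reindexSum 𝒜 e x k = x (e.toEquiv.symm k) :=
  DirectSum.equivCongrLeft_apply _ _ _

variable [DecidableEq κ]

/-- Transport of a single-component element `of`. -/
theorem reindexSum_of (k : κ) (m : ↥(𝒜 (e.toEquiv.symm k))) :
    reindexSum 𝒜 e (DirectSum.of (fun i => ↥(𝒜 i)) (e.toEquiv.symm k) m) =
      DirectSum.of (fun k => ↥(reindex 𝒜 e k)) k m := by
  refine DFinsupp.ext fun k' => ?_
  rw [reindexSum_apply]
  by_cases h : k = k'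
  · subst h
    rw [DirectSum.of_eq_same, DirectSum.of_eq_same]
  · rw [DirectSum.of_eq_of_ne _ _ _ (fun h' => h (e.toEquiv.symm.injective h').symm),
      DirectSum.of_eq_of_ne _ _ _ (Ne.symm h)]

/-- Transport along `e` does not change the underlying element of `B`. -/
theorem coe_reindexSum (x : ⨁ i, ↥(𝒜 i)) :
    DirectSum.coeAddMonoidHom (reindex 𝒜 e) (reindexSum 𝒜 e x) = DirectSum.coeAddMonoidHom 𝒜 x := by
  have key : (DirectSum.coeAddMonoidHom (reindex 𝒜 e)).comp (reindexSum 𝒜 e).toAddMonoidHom =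
      DirectSum.coeAddMonoidHom 𝒜 := by
    refine DirectSum.addHom_ext fun i m => ?_
    obtain ⟨k, rfl⟩ := e.toEquiv.symm.surjective i
    rw [AddMonoidHom.comp_apply, AddEquiv.coe_toAddMonoidHom, reindexSum_of,
      DirectSum.coeAddMonoidHom_of, DirectSum.coeAddMonoidHom_of]
  exact DFunLike.congr_fun key x

/-- The decomposition of the re-indexed grading. -/
@[reducible] def reindexDecomposition : DirectSum.Decomposition (reindex 𝒜 e) where
  decompose' := fun b => reindexSum 𝒜 e (DirectSum.decompose 𝒜 b)
  left_inv := fun b => by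
    change DirectSum.coeAddMonoidHom (reindex 𝒜 e) (reindexSum 𝒜 e (DirectSum.decompose 𝒜 b)) = b
    rw [coe_reindexSum]
    exact DirectSum.Decomposition.left_inv (ℳ := 𝒜) b
  right_inv := fun x => by
    change reindexSum 𝒜 e (DirectSum.decompose 𝒜 (DirectSum.coeAddMonoidHom (reindex 𝒜 e) x)) = x
    obtain ⟨y, rfl⟩ := (reindexSum 𝒜 e).surjective x
    rw [coe_reindexSum]
    congr 1
    exact DirectSum.Decomposition.right_inv (ℳ := 𝒜) y

/-- **The re-indexed grading is a ring grading.** [OURS · L1 W4.5c] -/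
@[reducible] def reindexGradedRing : GradedRing (reindex 𝒜 e) :=
  { reindex_gradedMonoid 𝒜 e, reindexDecomposition 𝒜 e with }

/-- **Tame nodes are stable under re-indexing of the grading group.** [OURS · L1 W4.5c] -/
theorem isTameNode_reindex (p : ℕ) (σ : B ≃+* B) (h : IsTameNode p B 𝒜 σ) :
    letI := reindexGradedRing 𝒜 e
    IsTameNode p B (reindex 𝒜 e) σ := by
  letI := reindexGradedRing 𝒜 e
  obtain ⟨hN, hR, ⟨s, hs, hfi⟩, ⟨t, ht⟩, hσ, hp⟩ := h
  refine ⟨hN, hR, ⟨s.map e.toEquiv.toEmbedding, ?_, ?_⟩, ⟨t, ?_⟩, ?_, hp⟩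
  · intro d hd
    rw [Finset.mem_map] at hd
    obtain ⟨d₀, hd₀, rfl⟩ := hd
    obtain ⟨u, hu, hmem⟩ := hs d₀ hd₀
    refine ⟨u, hu, ?_⟩
    change u ∈ 𝒜 (e.symm (e d₀))
    rwa [e.symm_apply_apply]
  · have hco : ((s.map e.toEquiv.toEmbedding : Finset κ) : Set κ) = e.toAddMonoidHom '' (s : Set ι) := by
      rw [Finset.coe_map]
      rfl
    rw [hco, ← AddMonoidHom.map_closure, AddSubgroup.finiteIndex_iff,
      AddSubgroup.index_map_of_bijective (show Function.Bijective e.toAddMonoidHom from e.bijective)]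
    exact AddSubgroup.finiteIndex_iff.1 hfi
  · rw [reindex_zero]
    exact ht
  · intro d b hb
    exact hσ _ b hb

end Reindex

/-! ## The concrete re-indexing `ℤ × Π j, ZMod (r j) ≃+ Π j, ZMod (Fin.cons 0 r j)` -/

section Cons

variable {m : ℕ} (r : Fin m → ℕ)

/-- `ℤ = ZMod 0 ≃+ ZMod (Fin.cons 0 r 0)`. -/
def zmodConsZero : ℤ ≃+ ZMod ((Fin.cons 0 r : Fin (m + 1) → ℕ) 0) :=
  (ZMod.ringEquivCongr (show ((Fin.cons 0 r : Fin (m + 1) → ℕ) 0) = 0 from Fin.cons_zero _ _)).symm.toAddEquiv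

/-- `ZMod (r j) ≃+ ZMod (Fin.cons 0 r j.succ)`. -/
def zmodConsSucc (j : Fin m) : ZMod (r j) ≃+ ZMod ((Fin.cons 0 r : Fin (m + 1) → ℕ) j.succ) :=
  (ZMod.ringEquivCongr (show ((Fin.cons 0 r : Fin (m + 1) → ℕ) j.succ) = r j from
    Fin.cons_succ _ _ _)).symm.toAddEquiv

/-- **The re-indexing of one weighted move**: the Rees bigrading group `ℤ × Π j : Fin m, ZMod (r j)` IS a D2-T
grading group `Π j : Fin (m+1), ZMod (rʼ j)` with `rʼ = Fin.cons 0 r` (new torus coordinate first). [OURS · L1 W4.5c] -/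
def consIndexEquiv :
    (ℤ × (Π j : Fin m, ZMod (r j))) ≃+ Π j : Fin (m + 1), ZMod ((Fin.cons 0 r : Fin (m + 1) → ℕ) j) :=
  (AddEquiv.prodCongr (zmodConsZero r) (AddEquiv.piCongrRight fun j => zmodConsSucc r j)).trans
    (Fin.consLinearEquiv ℤ (fun j : Fin (m + 1) => ZMod ((Fin.cons 0 r : Fin (m + 1) → ℕ) j))).toAddEquiv

end Cons

/-! ## The D2-T bridge for Rees-bigraded tame nodes -/

section Bridge

/-- Equal degree-`0` parts of two gradings of the same ring are ring-isomorphic (the ring structures are both the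
ambient one). -/
def gradeZeroEquivOfEq {ι κ : Type*} [AddCommGroup ι] [DecidableEq ι] [AddCommGroup κ] [DecidableEq κ]
    {B : Type u} [CommRing B] (𝒜 : ι → AddSubgroup B) [GradedRing 𝒜] (𝒜' : κ → AddSubgroup B) [GradedRing 𝒜']
    (h : 𝒜' 0 = 𝒜 0) : ↥(𝒜 0) ≃+* ↥(𝒜' 0) where
  toFun := fun x => ⟨x, by rw [h]; exact x.2⟩
  invFun := fun x => ⟨x, by rw [← h]; exact x.2⟩
  left_inv := fun _ => rfl
  right_inv := fun _ => rfl
  map_mul' := fun _ _ => rfl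
  map_add' := fun _ _ => rfl

/-- **Bridge**: the degree-`0` part of a tame node bigraded by `ℤ × Π j : Fin m, ZMod (r j)` (one weighted move on
a `Π ZMod`-graded node) is a TAME ROOT CHART (D2-T `S1.IsTameRootChart`, grading group `Π j : Fin (m+1), ZMod (rʼ j)`,
`rʼ = Fin.cons 0 r`). [OURS · L1 W4.5c] -/
theorem isTameRootChart_degreeZero_of_isTameNode_prod (p : ℕ) {m : ℕ} (r : Fin m → ℕ) (B : Type u) [CommRing B]
    (𝒜 : (ℤ × (Π j : Fin m, ZMod (r j))) → AddSubgroup B) [GradedRing 𝒜] (σ : B ≃+* B)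
    (h : IsTameNode p B 𝒜 σ) : IsTameRootChart (↥(𝒜 0)) := by
  letI := reindexGradedRing 𝒜 (consIndexEquiv r)
  have h' := isTameNode_reindex 𝒜 (consIndexEquiv r) p σ h
  obtain ⟨hN, hR, hT1, hT2, -, -⟩ := h'
  exact ⟨m + 1, Fin.cons 0 r, B, inferInstance, reindex 𝒜 (consIndexEquiv r), inferInstance, hN, hR, hT1, hT2,
    ⟨gradeZeroEquivOfEq 𝒜 (reindex 𝒜 (consIndexEquiv r)) (reindex_zero 𝒜 _)⟩⟩

end Bridge

end Summit.ResolutionOfSingularities.ResolutionOfSingularities.Theorems.WildQuotientResolution.S1.ProducerStep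

end
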